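import Literature.AlgebraicGeometry.Frobenioids.RealificationDataCanonical
import Literature.AlgebraicGeometry.Frobenioids.RealificationModelRow
import HarnessLib

/-!
# Frobenioids I, Prop. 5.3 / Cor. 5.4: functoriality of THE realification in the monoid — `f^rlf`,
# `η^rlf : Φ^rlf → Φ'^rlf`, and the induced functor `C^rlf → C'^rlf` of model Frobenioids

Mochizuki, *The geometry of Frobenioids I: the general theory*, Kyushu J. Math. **62** (2008) 293–400,
§5, Proposition 5.3 p. 103 ("the divisor monoid `Φ^rlf`", "the functors that arise naturally from the
construction of the … 'realification'") and Corollary 5.4 pp. 103–104 ("there exists a 1-unique functor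
`Ψ^rlf : C₁^rlf → C₂^rlf` that fits into a 1-commutative diagram `C₁ → C₂` / `C₁^rlf → C₂^rlf`")
[cite: MochizukiFrdI2008, Prop. 5.3 p.103] [cite: MochizukiFrdI2008, Cor. 5.4 p.103].

The realification is functorial not only in the objects of the base category (`rlfFunctor`,
`RealificationFunctor.lean`, seat abc-iut-L2-d2) but in the MONOID: a homomorphism `f : M → N` of
perf-factorial monoids induces `f^rlf : M^rlf → N^rlf` (universal property, `RlfUniversal.existsUnique_map`),
and a homomorphism `η : Φ → Φ'` of perf-factorial monoids on `D` induces `η^rlf : Φ^rlf → Φ'^rlf`.  This file: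

* `IsPerfFactorial.Rlf.map hM hN f` (`f^rlf`) with `map_toRealification`, uniqueness `eq_map`, `map_id'`,
  `map_comp'`, `ℝ_{≥0}`-equivariance `map_rpow'`, and `rlfMap_eq_map` (L2-d2's `rlfMap` is `map` of `Φ(g)`);
* `RealificationData.rlfNatTrans η hΦ hΦ' : rlfFunctor Φ hΦ ⟶ rlfFunctor Φ' hΦ'` (`η^rlf`), compatible with
  `Φ → Φ^rlf` (`toRlf_rlfNatTrans`), `ℝ`-linear on the `(Φ^rlf)^gp` (`gpApp_rlfNatTrans_rsmul`), hence mapping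
  `ℝ · Ψ` into `ℝ · Ψ'` whenever `η^gp(Ψ) ⊆ Ψ'` (`gpApp_rlfNatTrans_mem_realSpan`);
* `RealificationData.rlfDataHom` / **`rlfModelMap`**: the data morphism `(Φ^rlf, ℝ · Ψ) → (Φ'^rlf, ℝ · Ψ')` and
  the induced functor of realified model Frobenioids `C^rlf → C'^rlf` — the model-description instance of
  the functor `Ψ^rlf` of Cor. 5.4 for functors `C → C'` arising from data morphisms — with the
  1-commutativity `rlfModelMapSquareIso : (C → C^rlf → C'^rlf) ≅ (C → C' → C'^rlf)`.

No statement of the paper is re-typed (`Cor54` itself, a schema over general Frobenioids, is untouched).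
Seat abc-iut-L1-d2 (cell abc-iut), row «FrdI:Def2.4(ii)-ℝ-action + I3-MERGE RealificationData»
(L1-lead R45 (4)).
-/

noncomputable section

namespace Literature.AlgebraicGeometry.Frobenioids

open CategoryTheory Opposite Function Literature.AnabelianGeometry.EtaleTheta

universe w v u

/-! ### `f^rlf : M^rlf → N^rlf` for a homomorphism of perf-factorial monoids -/

namespace IsPerfFactorial

namespace Rlf

variable {M : Type w} [CommMonoid M] (hM : IsPerfFactorial M)
variable {N : Type w} [CommMonoid N] (hN : IsPerfFactorial N)
variable {L : Type w} [CommMonoid L] (hL : IsPerfFactorial L)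

/-- **`f^rlf : M^rlf → N^rlf`**, the unique homomorphism over `f^pf : M^pf → N^pf` (universal property of
the realification; `ℝ` supports `N^rlf`). [cite: MochizukiFrdI2008, Prop. 5.3 p.103] -/
def map (f : M →* N) : hM.Rlf →* hN.Rlf :=
  Classical.choose (RlfUniversal.existsUnique_map hM hN hN.supports_rlf_R f).exists

/-- The defining property of `f^rlf`: it lies over `f^pf`. [cite: MochizukiFrdI2008, Prop. 5.3 p.103] -/
theorem map_comp_toRealification (f : M →* N) :
    (map hM hN f).comp hM.toRealification = hN.toRealification.comp (Perfection.map f) :=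
  Classical.choose_spec (RlfUniversal.existsUnique_map hM hN hN.supports_rlf_R f).exists

/-- `f^rlf` on the image of `M^pf`. [cite: MochizukiFrdI2008, Prop. 5.3 p.103] -/
theorem map_toRealification (f : M →* N) (a : Perfection M) :
    map hM hN f (hM.toRealification a) = hN.toRealification (Perfection.map f a) :=
  DFunLike.congr_fun (map_comp_toRealification hM hN f) a

/-- `f^rlf` on the image of `M`: `f^rlf(ι a) = ι(f a)`. [cite: MochizukiFrdI2008, Prop. 5.3 p.103] -/
theorem map_toRealification_of (f : M →* N) (a : M) :
    map hM hN f (hM.toRealification (Perfection.of M a)) = hN.toRealification (Perfection.of N (f a)) := by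
  rw [map_toRealification]
  rfl

/-- **Uniqueness**: a homomorphism `M^rlf → N^rlf` over `f^pf` IS `f^rlf`. [cite: MochizukiFrdI2008, Prop. 5.3 p.103] -/
theorem eq_map {f : M →* N} {φ : hM.Rlf →* hN.Rlf}
    (hφ : φ.comp hM.toRealification = hN.toRealification.comp (Perfection.map f)) : φ = map hM hN f :=
  (RlfUniversal.existsUnique_map hM hN hN.supports_rlf_R f).unique hφ (map_comp_toRealification hM hN f)

/-- `id^rlf = id`. [cite: MochizukiFrdI2008, Prop. 5.3 p.103] -/
theorem map_id' : map hM hM (MonoidHom.id M) = MonoidHom.id _ :=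
  RlfUniversal.map_id hM hM.supports_rlf_R _ (map_comp_toRealification hM hM _)

/-- `(g ∘ f)^rlf = g^rlf ∘ f^rlf`. [cite: MochizukiFrdI2008, Prop. 5.3 p.103] -/
theorem map_comp' (f : M →* N) (g : N →* L) : map hM hL (g.comp f) = (map hN hL g).comp (map hM hN f) :=
  RlfUniversal.map_comp hM hN hL hL.supports_rlf_R f g _ (map_comp_toRealification hM hN f) _
    (map_comp_toRealification hN hL g) _ (map_comp_toRealification hM hL _)

/-- `f^rlf` commutes with the powers `a ↦ a^r` (`RlfHomEquivariant.lean`). [cite: MochizukiFrdI2008, Prop. 5.3 p.103] -/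
theorem map_rpow' (f : M →* N) (r : NNReal) (a : hM.Rlf) : map hM hN f (rpow hM r a) = rpow hN r (map hM hN f a) :=
  map_rpow hM hN _ r a

/-- The realification functor's action on morphisms (`rlfMap`, `RealificationFunctor.lean`) is `(Φ(g))^rlf`.
[cite: MochizukiFrdI2008, Prop. 5.3 p.103] -/
theorem rlfMap_eq_map {J : Type u} [Category.{v} J] (Φ : J ⥤ CommMonCat.{w})
    (hΦ : ∀ j : J, IsPerfFactorial (Φ.obj j)) {j j' : J} (g : j ⟶ j') :
    rlfMap Φ hΦ g = map (hΦ j) (hΦ j') (Φ.map g).hom :=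
  eq_map (hΦ j) (hΦ j') (rlfMap_comp_toRealification Φ hΦ g)

end Rlf

end IsPerfFactorial

/-! ### `η^rlf : Φ^rlf → Φ'^rlf` for a homomorphism of perf-factorial monoids on `D` -/

namespace ModelFrobenioid

variable {D : Type u} [Category.{v} D] {Φ B : Dᵒᵖ ⥤ CommMonCat.{w}} {DivB : B ⟶ monoidGp Φ}

/-- The `hom` of `isoOfClsEq` is `(1, id, 0, 0)`. [cite: MochizukiFrdI2008, Thm. 5.2 (i) p.100] -/
@[simp] theorem isoOfClsEq_hom {A : D} {α β : Algebra.GrothendieckGroup (Φ.obj (op A))} (h : α = β) :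
    (isoOfClsEq (B := B) (DivB := DivB) h).hom = homOfClsEq h := rfl

/-- The `inv` of `isoOfClsEq` is `(1, id, 0, 0)`. [cite: MochizukiFrdI2008, Thm. 5.2 (i) p.100] -/
@[simp] theorem isoOfClsEq_inv {A : D} {α β : Algebra.GrothendieckGroup (Φ.obj (op A))} (h : α = β) :
    (isoOfClsEq (B := B) (DivB := DivB) h).inv = homOfClsEq h.symm := rfl

end ModelFrobenioid

namespace RealificationData

variable {D : Type u} [Category.{v} D] {Φ Φ' : Dᵒᵖ ⥤ CommMonCat.{w}}

/-- **`η^rlf : Φ^rlf → Φ'^rlf`**, the homomorphism of monoids on `D` with components `(η_X)^rlf`, between THE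
realifications; naturality by the uniqueness in the universal property. [cite: MochizukiFrdI2008, Prop. 5.3 p.103] -/
def rlfNatTrans (η : Φ ⟶ Φ') (hΦ : ∀ X : Dᵒᵖ, IsPerfFactorial (Φ.obj X))
    (hΦ' : ∀ X : Dᵒᵖ, IsPerfFactorial (Φ'.obj X)) : (canonical Φ hΦ).rlf ⟶ (canonical Φ' hΦ').rlf where
  app X := CommMonCat.ofHom (IsPerfFactorial.Rlf.map (hΦ X) (hΦ' X) (η.app X).hom)
  naturality X Y f := by
    apply CommMonCat.hom_ext
    change (IsPerfFactorial.Rlf.map (hΦ Y) (hΦ' Y) (η.app Y).hom).comp (rlfMap Φ hΦ f) =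
      (rlfMap Φ' hΦ' f).comp (IsPerfFactorial.Rlf.map (hΦ X) (hΦ' X) (η.app X).hom)
    rw [IsPerfFactorial.Rlf.rlfMap_eq_map, IsPerfFactorial.Rlf.rlfMap_eq_map,
      ← IsPerfFactorial.Rlf.map_comp', ← IsPerfFactorial.Rlf.map_comp']
    have h := congrArg CommMonCat.Hom.hom (η.naturality f)
    rw [CommMonCat.hom_comp, CommMonCat.hom_comp] at h
    rw [h]

/-- Components of `η^rlf`. [cite: MochizukiFrdI2008, Prop. 5.3 p.103] -/
@[simp] theorem rlfNatTrans_app_hom (η : Φ ⟶ Φ') (hΦ : ∀ X : Dᵒᵖ, IsPerfFactorial (Φ.obj X))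
    (hΦ' : ∀ X : Dᵒᵖ, IsPerfFactorial (Φ'.obj X)) (X : Dᵒᵖ) :
    ((rlfNatTrans η hΦ hΦ').app X).hom = IsPerfFactorial.Rlf.map (hΦ X) (hΦ' X) (η.app X).hom := rfl

/-- **Compatibility with `Φ → Φ^rlf`** for THE realification data: `(Φ → Φ^rlf → Φ'^rlf) = (Φ → Φ' → Φ'^rlf)`.
[cite: MochizukiFrdI2008, Prop. 5.3 p.103] -/
theorem toRlf_rlfNatTrans (η : Φ ⟶ Φ') (hΦ : ∀ X : Dᵒᵖ, IsPerfFactorial (Φ.obj X))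
    (hΦ' : ∀ X : Dᵒᵖ, IsPerfFactorial (Φ'.obj X)) :
    (canonical Φ hΦ).toRlf ≫ rlfNatTrans η hΦ hΦ' = η ≫ (canonical Φ' hΦ').toRlf := by
  ext X a
  exact IsPerfFactorial.Rlf.map_toRealification_of (hΦ X) (hΦ' X) (η.app X).hom a

/-- **`(η^rlf)^gp` is `ℝ`-linear** for THE `ℝ`-vector-space structures (automatic equivariance).
[cite: MochizukiFrdI2008, Prop. 5.3 p.103] -/
theorem gpApp_rlfNatTrans_rsmul (η : Φ ⟶ Φ') (hΦ : ∀ X : Dᵒᵖ, IsPerfFactorial (Φ.obj X))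
    (hΦ' : ∀ X : Dᵒᵖ, IsPerfFactorial (Φ'.obj X)) (X : D) (r : ℝ)
    (x : Algebra.GrothendieckGroup ((canonical Φ hΦ).rlf.obj (op X))) :
    gpApp (rlfNatTrans η hΦ hΦ') (op X) ((canonical Φ hΦ).rsmul X r x) =
      (canonical Φ' hΦ').rsmul X r (gpApp (rlfNatTrans η hΦ hΦ') (op X) x) :=
  IsPerfFactorial.Rlf.map_realSMul (hΦ (op X)) (hΦ' (op X)) _ r x

/-- `(η^rlf)^gp ∘ ι^gp = ι'^gp ∘ η^gp` on the groupifications (`ι = Φ → Φ^rlf`).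
[cite: MochizukiFrdI2008, Prop. 5.3 p.103] -/
theorem gpApp_rlfNatTrans_toRlfGp (η : Φ ⟶ Φ') (hΦ : ∀ X : Dᵒᵖ, IsPerfFactorial (Φ.obj X))
    (hΦ' : ∀ X : Dᵒᵖ, IsPerfFactorial (Φ'.obj X)) (X : D) (c : Algebra.GrothendieckGroup (Φ.obj (op X))) :
    gpApp (rlfNatTrans η hΦ hΦ') (op X) ((canonical Φ hΦ).toRlfGp X c) =
      (canonical Φ' hΦ').toRlfGp X (gpApp η (op X) c) := by
  have key : (gpApp (rlfNatTrans η hΦ hΦ') (op X)).comp ((canonical Φ hΦ).toRlfGp X) =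
      ((canonical Φ' hΦ').toRlfGp X).comp (gpApp η (op X)) := by
    apply MonGp.hom_ext
    intro a
    simp only [MonoidHom.comp_apply, RealificationData.toRlfGp, gpApp, MonGp.map_of]
    exact congrArg Algebra.GrothendieckGroup.of
      (IsPerfFactorial.Rlf.map_toRealification_of (hΦ (op X)) (hΦ' (op X)) (η.app (op X)).hom a)
  exact DFunLike.congr_fun key c

/-- **`(η^rlf)^gp` maps `ℝ · Ψ` into `ℝ · Ψ'`** when `η^gp(Ψ) ⊆ Ψ'`: on generators
`(η^rlf)^gp(r • ι(c)) = r • ι'(η^gp(c))`. [cite: MochizukiFrdI2008, Cor. 5.4 p.103] -/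
theorem gpApp_rlfNatTrans_mem_realSpan (η : Φ ⟶ Φ') (hΦ : ∀ X : Dᵒᵖ, IsPerfFactorial (Φ.obj X))
    (hΦ' : ∀ X : Dᵒᵖ, IsPerfFactorial (Φ'.obj X)) (Ψ : GpSubfunctor Φ) (Ψ' : GpSubfunctor Φ')
    (hη : ∀ (X : D) (c : Algebra.GrothendieckGroup (Φ.obj (op X))),
      c ∈ Ψ.carrier X → gpApp η (op X) c ∈ Ψ'.carrier X)
    (X : D) (x : Algebra.GrothendieckGroup ((canonical Φ hΦ).rlf.obj (op X)))
    (hx : x ∈ ((canonical Φ hΦ).realSpan Ψ).carrier X) :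
    gpApp (rlfNatTrans η hΦ hΦ') (op X) x ∈ ((canonical Φ' hΦ').realSpan Ψ').carrier X := by
  have hle : (Subgroup.closure ((canonical Φ hΦ).realSpanGen Ψ X)).map (gpApp (rlfNatTrans η hΦ hΦ') (op X)) ≤
      Subgroup.closure ((canonical Φ' hΦ').realSpanGen Ψ' X) := by
    rw [MonoidHom.map_closure]
    apply Subgroup.closure_mono
    rintro _ ⟨y, ⟨r, c, hc, rfl⟩, rfl⟩
    exact ⟨r, gpApp η (op X) c, hη X c hc, by rw [gpApp_rlfNatTrans_rsmul, gpApp_rlfNatTrans_toRlfGp]⟩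
  exact hle (Subgroup.mem_map_of_mem _ hx)

/-- **The data morphism `(Φ^rlf, ℝ · Ψ) → (Φ'^rlf, ℝ · Ψ')`** along `η^rlf` (for `η^gp(Ψ) ⊆ Ψ'`): the data of
the realified functor. [cite: MochizukiFrdI2008, Cor. 5.4 p.103] -/
def rlfDataHom (η : Φ ⟶ Φ') (hΦ : ∀ X : Dᵒᵖ, IsPerfFactorial (Φ.obj X))
    (hΦ' : ∀ X : Dᵒᵖ, IsPerfFactorial (Φ'.obj X)) (Ψ : GpSubfunctor Φ) (Ψ' : GpSubfunctor Φ')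
    (hη : ∀ (X : D) (c : Algebra.GrothendieckGroup (Φ.obj (op X))),
      c ∈ Ψ.carrier X → gpApp η (op X) c ∈ Ψ'.carrier X) :
    ModelFrobenioid.DataHom ((canonical Φ hΦ).realSpan Ψ).incl ((canonical Φ' hΦ').realSpan Ψ').incl :=
  ((canonical Φ hΦ).realSpan Ψ).dataHomOfLE ((canonical Φ' hΦ').realSpan Ψ') (rlfNatTrans η hΦ hΦ')
    fun X x hx => gpApp_rlfNatTrans_mem_realSpan η hΦ hΦ' Ψ Ψ' hη X x hx

/-- **The realification of a functor of model Frobenioids arising from a data morphism**: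
`C^rlf → C'^rlf` (model of `(Φ^rlf, ℝ · Ψ)` → model of `(Φ'^rlf, ℝ · Ψ')`), `(A, α) ↦ (A, (η^rlf)^gp(α))` —
the model-description instance of the functor `Ψ^rlf` of Cor. 5.4. [cite: MochizukiFrdI2008, Cor. 5.4 p.103] -/
abbrev rlfModelMap (η : Φ ⟶ Φ') (hΦ : ∀ X : Dᵒᵖ, IsPerfFactorial (Φ.obj X))
    (hΦ' : ∀ X : Dᵒᵖ, IsPerfFactorial (Φ'.obj X)) (Ψ : GpSubfunctor Φ) (Ψ' : GpSubfunctor Φ')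
    (hη : ∀ (X : D) (c : Algebra.GrothendieckGroup (Φ.obj (op X))),
      c ∈ Ψ.carrier X → gpApp η (op X) c ∈ Ψ'.carrier X) :
    (canonical Φ hΦ).RlfModelOf Ψ ⥤ (canonical Φ' hΦ').RlfModelOf Ψ' :=
  (rlfDataHom η hΦ hΦ' Ψ Ψ' hη).functor

section Square

variable (η : Φ ⟶ Φ') (hΦ : ∀ X : Dᵒᵖ, IsPerfFactorial (Φ.obj X))
  (hΦ' : ∀ X : Dᵒᵖ, IsPerfFactorial (Φ'.obj X)) (Ψ : GpSubfunctor Φ) (Ψ' : GpSubfunctor Φ')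
  (hη : ∀ (X : D) (c : Algebra.GrothendieckGroup (Φ.obj (op X))),
    c ∈ Ψ.carrier X → gpApp η (op X) c ∈ Ψ'.carrier X)

/-- `C^rlf → C'^rlf` is the identity on base objects. [cite: MochizukiFrdI2008, Cor. 5.4 p.103] -/
theorem rlfModelMap_obj_base (A : (canonical Φ hΦ).RlfModelOf Ψ) :
    ((rlfModelMap η hΦ hΦ' Ψ Ψ' hη).obj A).base = A.base := rfl

/-- On classes `C^rlf → C'^rlf` is `(η^rlf)^gp`. [cite: MochizukiFrdI2008, Cor. 5.4 p.103] -/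
theorem rlfModelMap_obj_cls (A : (canonical Φ hΦ).RlfModelOf Ψ) :
    ((rlfModelMap η hΦ hΦ' Ψ Ψ' hη).obj A).cls = gpApp (rlfNatTrans η hΦ hΦ') (op A.base) A.cls := rfl

/-- **1-commutativity `(C → C^rlf → C'^rlf) ≅ (C → C' → C'^rlf)`** for the functors of model Frobenioids
induced by `η` (with `η^gp(Ψ) ⊆ Ψ'`) and by `η^rlf`: on objects both composites send `(A, α)` to
`(A, ι'^gp(η^gp(α))) = (A, (η^rlf)^gp(ι^gp(α)))`; the isomorphism is `(1, id, 0, 0)` componentwise.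
[cite: MochizukiFrdI2008, Cor. 5.4 p.103] -/
def rlfModelMapSquareIso :
    (canonical Φ hΦ).toRlfModel Ψ ⋙ rlfModelMap η hΦ hΦ' Ψ Ψ' hη ≅
      (Ψ.dataHomOfLE Ψ' η hη).functor ⋙ (canonical Φ' hΦ').toRlfModel Ψ' :=
  NatIso.ofComponents
    (fun X => ModelFrobenioid.isoOfClsEq (gpApp_rlfNatTrans_toRlfGp η hΦ hΦ' X.base X.cls))
    (fun {X Y} φ => by
      apply ModelFrobenioid.hom_ext
      · rw [ModelFrobenioid.degFr_comp, ModelFrobenioid.degFr_comp, ModelFrobenioid.isoOfClsEq_hom,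
          ModelFrobenioid.isoOfClsEq_hom, ModelFrobenioid.degFr_homOfClsEq, ModelFrobenioid.degFr_homOfClsEq,
          one_mul, mul_one]
        rfl
      · change ModelFrobenioid.baseMap φ ≫ 𝟙 Y.base = 𝟙 X.base ≫ ModelFrobenioid.baseMap φ
        rw [Category.comp_id, Category.id_comp]
      · change ((canonical Φ' hΦ').rlf.map (ModelFrobenioid.baseMap φ).op).hom 1 *
            ((rlfNatTrans η hΦ hΦ').app (op X.base)).hom
              (((canonical Φ hΦ).toRlf.app (op X.base)).hom (ModelFrobenioid.div φ)) ^ ((1 : ℕ+) : ℕ) =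
          ((canonical Φ' hΦ').rlf.map (𝟙 X.base).op).hom
              (((canonical Φ' hΦ').toRlf.app (op X.base)).hom ((η.app (op X.base)).hom (ModelFrobenioid.div φ))) *
            1 ^ (ModelFrobenioid.degFr φ : ℕ)
        rw [map_one, one_mul, PNat.one_coe, pow_one, one_pow, mul_one, op_id, CategoryTheory.Functor.map_id]
        exact IsPerfFactorial.Rlf.map_toRealification_of (hΦ _) (hΦ' _) (η.app _).hom (ModelFrobenioid.div φ)
      · change (((canonical Φ' hΦ').realSpan Ψ').toMonoid.map (ModelFrobenioid.baseMap φ).op).hom 1 *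
            ((rlfDataHom η hΦ hΦ' Ψ Ψ' hη).β.app (op X.base)).hom
              ((((canonical Φ hΦ).ofBaseData Ψ).β.app (op X.base)).hom (ModelFrobenioid.unit φ)) ^ ((1 : ℕ+) : ℕ) =
          (((canonical Φ' hΦ').realSpan Ψ').toMonoid.map (𝟙 X.base).op).hom
              ((((canonical Φ' hΦ').ofBaseData Ψ').β.app (op X.base)).hom
                (((Ψ.dataHomOfLE Ψ' η hη).β.app (op X.base)).hom (ModelFrobenioid.unit φ))) *
            1 ^ (ModelFrobenioid.degFr φ : ℕ)
        rw [map_one, one_mul, PNat.one_coe, pow_one, one_pow, mul_one, op_id, CategoryTheory.Functor.map_id]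
        apply Subtype.ext
        exact gpApp_rlfNatTrans_toRlfGp η hΦ hΦ' X.base _)

end Square

end RealificationData

end Literature.AlgebraicGeometry.Frobenioids
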